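import Mathlib
import Literature.MathematicalPhysics.KineticTheory.HardSphereEuler
import Literature.MathematicalPhysics.KineticTheory.HardSphereEntranceProofs
import Summits.AtomisticToContinuum.HydrodynamicLimit.Theorems.OneFlightGossipEngineOneFlightLayeredChaosDiscRegimes
import HarnessLib

/-!
# `OneFlightGossipEngine.OneFlightLayeredChaos` — disc flatness from translation quasi-invariance, BUNDLE form
(crux stmt-AtomisticToContinuum-14535, line `Sketch`, lead cycle c3; TransQuasiInv layer 2/3; registered stub
`disc_flat_bundle_of_quasiInvariant`)

The frame-free version of the line's Mathlib-only brick `disc_flat_of_quasiInvariant` (`…DiscFlat.lean`), stated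
directly for a pair of random vectors `(g, b)` of `ℝ³ × ℝ³` under a finite measure `P` on an abstract space, with
`g` a unit vector on the base event `F` and `b` meant to lie in the open unit disc `D_g = {u | ⟪u, g⟫ = 0, ‖u‖ < 1}` of
the plane `g^⊥`.  Shifts are taken in `ℝ³` and projected onto `g^⊥` by `Π_g δ = δ − ⟪δ, g⟫ g`, so no measurable
frame field on the sphere is needed.  HYPOTHESIS (event-level translation quasi-invariance, error `η`): for every
`δ ∈ ℝ³` and every measurable `S ⊆ ℝ³ × ℝ³`,
`|P(F ∩ {(g, b) ∈ S, b ∈ D_g, b − Π_g δ ∈ D_g}) − P(F ∩ {(g, b + Π_g δ) ∈ S, b + Π_g δ ∈ D_g, b ∈ D_g})| ≤ η`.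
CONCLUSION: for every measurable `S`,
`|P(F ∩ {(g, b) ∈ S, b ∈ D_g}) − ∫_{F ∩ {b ∈ D_g}} discLaw g S_g dP| ≤ 36 η`, `discLaw g` being the uniform law of
the unit disc of `g^⊥` of the disc-form frame (`…DiscRegimes.lean`, a ratio of volumes of solid cylinders of `ℝ³`).

Proof: Tonelli on `ℝ³ × Ω` for `vol ⊗ P` and the two sets
`T₁ = {(δ, z) | ‖δ‖ ≤ 3, z ∈ F, ⟪δ, g⟫ ∈ (0, 1], (g, b) ∈ S, b ∈ D_g, b − Π_g δ ∈ D_g}`,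
`T₂ = {(δ, z) | ‖δ‖ ≤ 3, z ∈ F, ⟪δ, g⟫ ∈ (0, 1], (g, b + Π_g δ) ∈ S, b + Π_g δ ∈ D_g, b ∈ D_g}` (`g = g(z)`, `b = b(z)`).
The `δ`-section of `T₁` at `z` is the translate by `b` of the solid unit cylinder `{⟪x, g⟫ ∈ (0, 1], ‖Π_g x‖ < 1}`
(volume `π`), that of `T₂` the translate by `−b` of the cylinder over `S_g ∩ D_g` (volume `π · discLaw g S_g`); the
`z`-sections at `δ` are the two events of the hypothesis with `S` cut down to `{⟪δ, g'⟫ ∈ (0, 1]}`, so they differ in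
mass by `≤ η` for `‖δ‖ ≤ 3` and are empty beyond; integrating, `|π P(…) − π ∫ discLaw| ≤ η · vol B(0, 3) = 36 π η`.
-/

open MeasureTheory Set Metric
open scoped ENNReal
open Literature.MathematicalPhysics.KineticTheory

namespace Summit.AtomisticToContinuum.HydrodynamicLimit.Theorems.OLC

noncomputable section

/-! ## The solid unit cylinder over the disc of `g^⊥` -/

/-- The solid open unit cylinder `{⟪x, g⟫ ∈ (0, 1], ‖x − ⟪x, g⟫ g‖ < 1}` of a unit vector `g` has the volume of the
unit disc (Cavalieri in adapted cylindrical coordinates, `volume_discCylinder_eq`). [folklore] -/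
theorem volume_discCylinder_univ (g : V3) (hg : ‖g‖ = 1) :
    volume {x : V3 | inner ℝ x g ∈ Set.Ioc (0 : ℝ) 1 ∧ ‖x - inner ℝ x g • g‖ < 1} =
      volume (Metric.ball (0 : EuclideanSpace ℝ (Fin 2)) 1) := by
  have he : ‖-g‖ = 1 := by rw [norm_neg, hg]
  have hn : Module.finrank ℝ V3 = 2 + 1 := by rw [finrank_euclideanSpace_fin]
  obtain ⟨ι, hι, hmp⟩ := exists_axisDecomposition hn (-g) he
  have h := volume_discCylinder_eq g hg ι hι hmp MeasurableSet.univ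
  simpa using h

/-- The volume of the unit disc is positive and finite: `vol B₁(ℝ²) ≠ 0`. [folklore] -/
theorem volume_unitBall_two_ne_zero : volume (Metric.ball (0 : EuclideanSpace ℝ (Fin 2)) 1) ≠ 0 :=
  (Metric.measure_ball_pos volume (0 : EuclideanSpace ℝ (Fin 2)) one_pos).ne'

/-- The volume of the unit disc is positive and finite: `vol B₁(ℝ²) ≠ ∞`. [folklore] -/
theorem volume_unitBall_two_ne_top : volume (Metric.ball (0 : EuclideanSpace ℝ (Fin 2)) 1) ≠ ∞ :=
  measure_ball_lt_top.ne

/-- `discLaw` is nonnegative. [folklore] -/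
theorem discLaw_nonneg (g : V3) (U : Set V3) : 0 ≤ discLaw g U := ENNReal.toReal_nonneg

/-- `discLaw` is at most one (the numerator cylinder sits inside the denominator cylinder). [folklore] -/
theorem discLaw_le_one (g : V3) (U : Set V3) : discLaw g U ≤ 1 := by
  unfold discLaw
  refine ENNReal.toReal_le_of_le_ofReal zero_le_one ?_
  rw [ENNReal.ofReal_one]
  exact ENNReal.div_le_of_le_mul (by rw [one_mul]; exact measure_mono fun x hx => ⟨hx.1, hx.2.1⟩)

/-- **The numerator cylinder in terms of `discLaw`**: for a unit vector `g`,
`vol{⟪x, g⟫ ∈ (0, 1], ‖Π_g x‖ < 1, Π_g x ∈ U} = discLaw g U · vol B₁(ℝ²)`. [folklore] -/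
theorem volume_discCylinder_inter_eq (g : V3) (hg : ‖g‖ = 1) (U : Set V3) :
    volume {x : V3 | inner ℝ x g ∈ Set.Ioc (0 : ℝ) 1 ∧ ‖x - inner ℝ x g • g‖ < 1 ∧ x - inner ℝ x g • g ∈ U} =
      ENNReal.ofReal (discLaw g U) * volume (Metric.ball (0 : EuclideanSpace ℝ (Fin 2)) 1) := by
  have hle : volume {x : V3 | inner ℝ x g ∈ Set.Ioc (0 : ℝ) 1 ∧ ‖x - inner ℝ x g • g‖ < 1 ∧ x - inner ℝ x g • g ∈ U} ≤
      volume (Metric.ball (0 : EuclideanSpace ℝ (Fin 2)) 1) := by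
    rw [← volume_discCylinder_univ g hg]
    exact measure_mono fun x hx => ⟨hx.1, hx.2.1⟩
  have hfin : volume {x : V3 | inner ℝ x g ∈ Set.Ioc (0 : ℝ) 1 ∧ ‖x - inner ℝ x g • g‖ < 1 ∧ x - inner ℝ x g • g ∈ U} ≠
      ∞ := ne_top_of_le_ne_top volume_unitBall_two_ne_top hle
  rw [discLaw, volume_discCylinder_univ g hg, ENNReal.ofReal_toReal (ENNReal.div_ne_top hfin volume_unitBall_two_ne_zero),
    ENNReal.div_mul_cancel volume_unitBall_two_ne_zero volume_unitBall_two_ne_top]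

/-- **`discLaw` along a measurable direction field is measurable**: for measurable `g : Ω → ℝ³` and measurable
`S ⊆ ℝ³ × ℝ³`, `z ↦ discLaw (g z) {u | (g z, u) ∈ S}` is measurable (sections of measurable subsets of `Ω × ℝ³` have
measurably varying volume). [folklore] -/
theorem measurable_discLaw_comp {Ω : Type*} [MeasurableSpace Ω] {g : Ω → V3} (hg : Measurable g)
    {S : Set (V3 × V3)} (hS : MeasurableSet S) :
    Measurable fun z => discLaw (g z) {u | (g z, u) ∈ S} := by
  unfold discLaw
  have hin : Measurable fun p : Ω × V3 => inner ℝ p.2 (g p.1) := measurable_snd.inner (hg.comp measurable_fst)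
  have hpr : Measurable fun p : Ω × V3 => p.2 - inner ℝ p.2 (g p.1) • g p.1 :=
    measurable_snd.sub (hin.smul (hg.comp measurable_fst))
  have h1 : MeasurableSet {p : Ω × V3 | inner ℝ p.2 (g p.1) ∈ Set.Ioc (0 : ℝ) 1} := hin measurableSet_Ioc
  have h2 : MeasurableSet {p : Ω × V3 | ‖p.2 - inner ℝ p.2 (g p.1) • g p.1‖ < 1} :=
    measurableSet_lt hpr.norm measurable_const
  have h3 : MeasurableSet {p : Ω × V3 | (g p.1, p.2 - inner ℝ p.2 (g p.1) • g p.1) ∈ S} :=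
    ((hg.comp measurable_fst).prodMk hpr) hS
  have hnum : MeasurableSet {p : Ω × V3 | inner ℝ p.2 (g p.1) ∈ Set.Ioc (0 : ℝ) 1 ∧
      ‖p.2 - inner ℝ p.2 (g p.1) • g p.1‖ < 1 ∧ (g p.1, p.2 - inner ℝ p.2 (g p.1) • g p.1) ∈ S} := by
    simp only [Set.setOf_and]
    exact h1.inter (h2.inter h3)
  have hden : MeasurableSet {p : Ω × V3 | inner ℝ p.2 (g p.1) ∈ Set.Ioc (0 : ℝ) 1 ∧
      ‖p.2 - inner ℝ p.2 (g p.1) • g p.1‖ < 1} := by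
    simp only [Set.setOf_and]
    exact h1.inter h2
  have hN : Measurable fun z => volume {x : V3 | inner ℝ x (g z) ∈ Set.Ioc (0 : ℝ) 1 ∧
      ‖x - inner ℝ x (g z) • g z‖ < 1 ∧ x - inner ℝ x (g z) • g z ∈ {u | (g z, u) ∈ S}} :=
    measurable_measure_prodMk_left hnum
  have hD : Measurable fun z => volume {x : V3 | inner ℝ x (g z) ∈ Set.Ioc (0 : ℝ) 1 ∧
      ‖x - inner ℝ x (g z) • g z‖ < 1} :=
    measurable_measure_prodMk_left hden
  exact (hN.div hD).ennreal_toReal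

/-- The bundle of open unit discs `{(g, u) | ⟪u, g⟫ = 0, ‖u‖ < 1}` is a measurable subset of `ℝ³ × ℝ³`. [folklore] -/
theorem measurableSet_discBundle : MeasurableSet {q : V3 × V3 | inner ℝ q.2 q.1 = 0 ∧ ‖q.2‖ < 1} := by
  have hin : Measurable fun q : V3 × V3 => inner ℝ q.2 q.1 := measurable_snd.inner measurable_fst
  simp only [Set.setOf_and]
  exact (hin (measurableSet_singleton 0)).inter (measurableSet_lt measurable_snd.norm measurable_const)

/-- The transverse part `Π_g δ = δ − ⟪δ, g⟫ g` of a shift is orthogonal to the unit vector `g`. [folklore] -/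
theorem inner_transversePart_eq_zero (g δ : V3) (hg : ‖g‖ = 1) : inner ℝ (δ - inner ℝ δ g • g) g = 0 := by
  rw [inner_sub_left, real_inner_smul_left, real_inner_self_eq_norm_sq, hg]
  ring

/-- `‖δ‖ ≤ ‖Π_g δ‖ + |⟪δ, g⟫|` for a unit vector `g`. [folklore] -/
theorem norm_le_norm_transversePart_add (g δ : V3) (hg : ‖g‖ = 1) :
    ‖δ‖ ≤ ‖δ - inner ℝ δ g • g‖ + |inner ℝ δ g| := by
  calc ‖δ‖ = ‖(δ - inner ℝ δ g • g) + inner ℝ δ g • g‖ := by rw [sub_add_cancel]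
    _ ≤ ‖δ - inner ℝ δ g • g‖ + ‖inner ℝ δ g • g‖ := norm_add_le _ _
    _ = ‖δ - inner ℝ δ g • g‖ + |inner ℝ δ g| := by rw [norm_smul, hg, mul_one, Real.norm_eq_abs]

/-- `vol B₃(0, 3) = 36 · vol B₂(0, 1)` in real numbers (`36π = 36 · π`). [folklore] -/
theorem volume_real_closedBall_three_eq :
    (volume (Metric.closedBall (0 : V3) 3)).toReal = 36 * (volume (Metric.ball (0 : EuclideanSpace ℝ (Fin 2)) 1)).toReal := by
  rw [EuclideanSpace.volume_closedBall_fin_three, EuclideanSpace.volume_ball_fin_two, ENNReal.toReal_mul,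
    ENNReal.toReal_mul, ← ENNReal.ofReal_pow (by norm_num), ← ENNReal.ofReal_pow (by norm_num),
    ENNReal.toReal_ofReal (by positivity), ENNReal.toReal_ofReal (by positivity),
    ENNReal.toReal_ofReal (by positivity), ENNReal.toReal_ofReal (by positivity)]
  ring

/-! ## The bundle-form brick -/

/-- **Disc flatness from translation quasi-invariance, bundle form** (registered stub
`disc_flat_bundle_of_quasiInvariant` of crux stmt-AtomisticToContinuum-14535, line `Sketch`). `P` a finite measure on
`Ω`, `g, b : Ω → ℝ³` measurable, `g` a unit vector on the measurable base event `F`, `D_g = {u | ⟪u, g⟫ = 0, ‖u‖ < 1}` the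
open unit disc of `g^⊥`, `Π_g δ = δ − ⟪δ, g⟫ g`. If for every shift `δ ∈ ℝ³` and every measurable `S ⊆ ℝ³ × ℝ³`
`|P(F ∩ {(g, b) ∈ S, b ∈ D_g, b − Π_g δ ∈ D_g}) − P(F ∩ {(g, b + Π_g δ) ∈ S, b + Π_g δ ∈ D_g, b ∈ D_g})| ≤ η`, then for every
measurable `S`: `|P(F ∩ {(g, b) ∈ S, b ∈ D_g}) − ∫_{F ∩ {b ∈ D_g}} discLaw g S_g dP| ≤ 36 η`. Tonelli on the two subsets
`T₁, T₂` of `ℝ³ × Ω` of the module docstring. [folklore] -/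
theorem disc_flat_bundle_of_quasiInvariant : ∀ {Ω : Type*} [MeasurableSpace Ω] (P : MeasureTheory.Measure Ω) [MeasureTheory.IsFiniteMeasure P] {g b : Ω → Literature.MathematicalPhysics.KineticTheory.V3}, Measurable g → Measurable b → ∀ {F : Set Ω}, MeasurableSet F → (∀ z ∈ F, ‖g z‖ = 1) → ∀ {η : ℝ}, 0 ≤ η → (∀ (δ : Literature.MathematicalPhysics.KineticTheory.V3) (S : Set (Literature.MathematicalPhysics.KineticTheory.V3 × Literature.MathematicalPhysics.KineticTheory.V3)), MeasurableSet S → |P.real (F ∩ {z | (g z, b z) ∈ S ∧ (inner ℝ (b z) (g z) = 0 ∧ ‖b z‖ < 1) ∧ (inner ℝ (b z - (δ - inner ℝ δ (g z) • g z)) (g z) = 0 ∧ ‖b z - (δ - inner ℝ δ (g z) • g z)‖ < 1)}) - P.real (F ∩ {z | (g z, b z + (δ - inner ℝ δ (g z) • g z)) ∈ S ∧ (inner ℝ (b z + (δ - inner ℝ δ (g z) • g z)) (g z) = 0 ∧ ‖b z + (δ - inner ℝ δ (g z) • g z)‖ < 1) ∧ (inner ℝ (b z) (g z) = 0 ∧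 ‖b z‖ < 1)})| ≤ η) → ∀ {S : Set (Literature.MathematicalPhysics.KineticTheory.V3 × Literature.MathematicalPhysics.KineticTheory.V3)}, MeasurableSet S → |P.real (F ∩ {z | (g z, b z) ∈ S ∧ (inner ℝ (b z) (g z) = 0 ∧ ‖b z‖ < 1)}) - ∫ z in F ∩ {z | inner ℝ (b z) (g z) = 0 ∧ ‖b z‖ < 1}, Summit.AtomisticToContinuum.HydrodynamicLimit.Theorems.OLC.discLaw (g z) {u | (g z, u) ∈ S} ∂P| ≤ 36 * η := by
  intro Ω _ P _ g b hg hb F hF hunit η hη h S hS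
  -- measurable building blocks
  have hDb := measurableSet_discBundle
  have hgb : Measurable fun z => (g z, b z) := hg.prodMk hb
  have hbD : MeasurableSet {z | inner ℝ (b z) (g z) = 0 ∧ ‖b z‖ < 1} := hDb.preimage hgb
  -- the target event and the base of the compensator
  set A : Set Ω := F ∩ {z | (g z, b z) ∈ S ∧ (inner ℝ (b z) (g z) = 0 ∧ ‖b z‖ < 1)} with hA
  set FD : Set Ω := F ∩ {z | inner ℝ (b z) (g z) = 0 ∧ ‖b z‖ < 1} with hFD
  have hAm : MeasurableSet A := by
    rw [hA, Set.setOf_and]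
    exact hF.inter ((hgb hS).inter hbD)
  have hFDm : MeasurableSet FD := hF.inter hbD
  -- the unit-disc volume
  set V₀ : ℝ≥0∞ := volume (Metric.ball (0 : EuclideanSpace ℝ (Fin 2)) 1) with hV₀
  have hV0 : V₀ ≠ 0 := volume_unitBall_two_ne_zero
  have hVt : V₀ ≠ ∞ := volume_unitBall_two_ne_top
  -- the two product sets
  set B₃ : Set V3 := Metric.closedBall (0 : V3) 3 with hB₃
  have hB₃m : MeasurableSet B₃ := isClosed_closedBall.measurableSet
  set T₁ : Set (V3 × Ω) := {p | p.1 ∈ B₃ ∧ p.2 ∈ F ∧ inner ℝ p.1 (g p.2) ∈ Set.Ioc (0 : ℝ) 1 ∧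
      (g p.2, b p.2) ∈ S ∧ (inner ℝ (b p.2) (g p.2) = 0 ∧ ‖b p.2‖ < 1) ∧
      (inner ℝ (b p.2 - (p.1 - inner ℝ p.1 (g p.2) • g p.2)) (g p.2) = 0 ∧
        ‖b p.2 - (p.1 - inner ℝ p.1 (g p.2) • g p.2)‖ < 1)} with hT₁
  set T₂ : Set (V3 × Ω) := {p | p.1 ∈ B₃ ∧ p.2 ∈ F ∧ inner ℝ p.1 (g p.2) ∈ Set.Ioc (0 : ℝ) 1 ∧
      (g p.2, b p.2 + (p.1 - inner ℝ p.1 (g p.2) • g p.2)) ∈ S ∧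
      (inner ℝ (b p.2 + (p.1 - inner ℝ p.1 (g p.2) • g p.2)) (g p.2) = 0 ∧
        ‖b p.2 + (p.1 - inner ℝ p.1 (g p.2) • g p.2)‖ < 1) ∧
      (inner ℝ (b p.2) (g p.2) = 0 ∧ ‖b p.2‖ < 1)} with hT₂
  -- measurability of the product sets
  have mg : Measurable fun p : V3 × Ω => g p.2 := hg.comp measurable_snd
  have mb : Measurable fun p : V3 × Ω => b p.2 := hb.comp measurable_snd
  have min : Measurable fun p : V3 × Ω => inner ℝ p.1 (g p.2) := measurable_fst.inner mg
  have mpr : Measurable fun p : V3 × Ω => p.1 - inner ℝ p.1 (g p.2) • g p.2 := measurable_fst.sub (min.smul mg)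
  have mB : MeasurableSet {p : V3 × Ω | p.1 ∈ B₃} := measurable_fst hB₃m
  have mF : MeasurableSet {p : V3 × Ω | p.2 ∈ F} := measurable_snd hF
  have mI : MeasurableSet {p : V3 × Ω | inner ℝ p.1 (g p.2) ∈ Set.Ioc (0 : ℝ) 1} := min measurableSet_Ioc
  have mD0 : MeasurableSet {p : V3 × Ω | inner ℝ (b p.2) (g p.2) = 0 ∧ ‖b p.2‖ < 1} := hDb.preimage (mg.prodMk mb)
  have hT₁m : MeasurableSet T₁ := by
    have mS : MeasurableSet {p : V3 × Ω | (g p.2, b p.2) ∈ S} := (mg.prodMk mb) hS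
    have mD : MeasurableSet {p : V3 × Ω | inner ℝ (b p.2 - (p.1 - inner ℝ p.1 (g p.2) • g p.2)) (g p.2) = 0 ∧
        ‖b p.2 - (p.1 - inner ℝ p.1 (g p.2) • g p.2)‖ < 1} := hDb.preimage (mg.prodMk (mb.sub mpr))
    rw [Set.setOf_and] at mD0 mD
    rw [hT₁]
    simp only [Set.setOf_and]
    exact mB.inter (mF.inter (mI.inter (mS.inter (mD0.inter mD))))
  have hT₂m : MeasurableSet T₂ := by
    have mS : MeasurableSet {p : V3 × Ω | (g p.2, b p.2 + (p.1 - inner ℝ p.1 (g p.2) • g p.2)) ∈ S} :=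
      (mg.prodMk (mb.add mpr)) hS
    have mD : MeasurableSet {p : V3 × Ω | inner ℝ (b p.2 + (p.1 - inner ℝ p.1 (g p.2) • g p.2)) (g p.2) = 0 ∧
        ‖b p.2 + (p.1 - inner ℝ p.1 (g p.2) • g p.2)‖ < 1} := hDb.preimage (mg.prodMk (mb.add mpr))
    rw [Set.setOf_and] at mD0 mD
    rw [hT₂]
    simp only [Set.setOf_and]
    exact mB.inter (mF.inter (mI.inter (mS.inter (mD.inter mD0))))
  -- Tonelli, integrating `δ` first: `(vol ⊗ P) T₁ = V₀ · P A`
  have hI₁ : (volume.prod P) T₁ = V₀ * P A := by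
    rw [Measure.prod_apply_symm hT₁m]
    have hfun : (fun z : Ω => volume ((fun δ : V3 => (δ, z)) ⁻¹' T₁)) = fun z => A.indicator (fun _ => V₀) z := by
      funext z
      by_cases hz : z ∈ A
      · have hzA := hz
        obtain ⟨hzF, hzS, hbg, hb1⟩ := hz
        have hu := hunit z hzF
        have hslice : (fun δ : V3 => (δ, z)) ⁻¹' T₁ =
            (fun δ : V3 => -b z + δ) ⁻¹' {x : V3 | inner ℝ x (g z) ∈ Set.Ioc (0 : ℝ) 1 ∧ ‖x - inner ℝ x (g z) • g z‖ < 1} := by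
          ext δ
          have h1 : inner ℝ (-b z + δ) (g z) = inner ℝ δ (g z) := by
            rw [inner_add_left, inner_neg_left, hbg, neg_zero, zero_add]
          have h2 : -b z + δ - inner ℝ δ (g z) • g z = -(b z - (δ - inner ℝ δ (g z) • g z)) := by abel
          simp only [hT₁, mem_preimage, mem_setOf_eq, h1, h2, norm_neg]
          constructor
          · rintro ⟨-, -, hin, -, -, -, hlt⟩
            exact ⟨hin, hlt⟩
          · rintro ⟨hin, hlt⟩
            refine ⟨?_, hzF, hin, hzS, ⟨hbg, hb1⟩, ?_, hlt⟩
            · rw [hB₃, mem_closedBall_zero_iff]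
              have hn := norm_le_norm_transversePart_add (g z) δ hu
              have hpr : ‖δ - inner ℝ δ (g z) • g z‖ ≤ ‖b z‖ + ‖b z - (δ - inner ℝ δ (g z) • g z)‖ := by
                calc ‖δ - inner ℝ δ (g z) • g z‖ = ‖b z - (b z - (δ - inner ℝ δ (g z) • g z))‖ := by
                      rw [sub_sub_cancel]
                  _ ≤ ‖b z‖ + ‖b z - (δ - inner ℝ δ (g z) • g z)‖ := norm_sub_le _ _
              have habs : |inner ℝ δ (g z)| ≤ 1 := abs_le.2 ⟨by linarith [hin.1], hin.2⟩
              linarith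
            · rw [inner_sub_left, hbg, inner_transversePart_eq_zero (g z) δ hu, sub_zero]
        rw [hslice, measure_preimage_add, volume_discCylinder_univ (g z) hu, indicator_of_mem hzA]
      · have hslice : (fun δ : V3 => (δ, z)) ⁻¹' T₁ = ∅ := by
          ext δ
          simp only [hT₁, mem_preimage, mem_setOf_eq, mem_empty_iff_false, iff_false]
          rintro ⟨-, hzF, -, hzS, hD, -⟩
          exact hz ⟨hzF, hzS, hD⟩
        rw [hslice, measure_empty, indicator_of_notMem hz]
    rw [hfun, lintegral_indicator_const hAm]
  -- Tonelli, integrating `δ` first: `(vol ⊗ P) T₂ = ∫_{FD} vol(cylinder over S_g ∩ D_g) dP`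
  have hI₂ : (volume.prod P) T₂ = ∫⁻ z in FD, volume {x : V3 | inner ℝ x (g z) ∈ Set.Ioc (0 : ℝ) 1 ∧
      ‖x - inner ℝ x (g z) • g z‖ < 1 ∧ x - inner ℝ x (g z) • g z ∈ {u | (g z, u) ∈ S}} ∂P := by
    rw [Measure.prod_apply_symm hT₂m, ← lintegral_indicator hFDm]
    congr 1
    funext z
    by_cases hz : z ∈ FD
    · have hzFD := hz
      obtain ⟨hzF, hbg, hb1⟩ := hz
      have hu := hunit z hzF
      have hslice : (fun δ : V3 => (δ, z)) ⁻¹' T₂ =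
          (fun δ : V3 => b z + δ) ⁻¹' {x : V3 | inner ℝ x (g z) ∈ Set.Ioc (0 : ℝ) 1 ∧
            ‖x - inner ℝ x (g z) • g z‖ < 1 ∧ x - inner ℝ x (g z) • g z ∈ {u | (g z, u) ∈ S}} := by
        ext δ
        have h1 : inner ℝ (b z + δ) (g z) = inner ℝ δ (g z) := by
          rw [inner_add_left, hbg, zero_add]
        have h2 : b z + δ - inner ℝ δ (g z) • g z = b z + (δ - inner ℝ δ (g z) • g z) := by abel
        simp only [hT₂, mem_preimage, mem_setOf_eq, h1, h2]
        constructor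
        · rintro ⟨-, -, hin, hS', ⟨-, hlt⟩, -⟩
          exact ⟨hin, hlt, hS'⟩
        · rintro ⟨hin, hlt, hS'⟩
          refine ⟨?_, hzF, hin, hS', ⟨?_, hlt⟩, hbg, hb1⟩
          · rw [hB₃, mem_closedBall_zero_iff]
            have hn := norm_le_norm_transversePart_add (g z) δ hu
            have hpr : ‖δ - inner ℝ δ (g z) • g z‖ ≤ ‖b z + (δ - inner ℝ δ (g z) • g z)‖ + ‖b z‖ := by
              calc ‖δ - inner ℝ δ (g z) • g z‖ = ‖(b z + (δ - inner ℝ δ (g z) • g z)) - b z‖ := by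
                    rw [add_sub_cancel_left]
                _ ≤ ‖b z + (δ - inner ℝ δ (g z) • g z)‖ + ‖b z‖ := norm_sub_le _ _
            have habs : |inner ℝ δ (g z)| ≤ 1 := abs_le.2 ⟨by linarith [hin.1], hin.2⟩
            linarith
          · rw [inner_add_left, hbg, inner_transversePart_eq_zero (g z) δ hu, zero_add]
      rw [hslice, measure_preimage_add, indicator_of_mem hzFD]
    · have hslice : (fun δ : V3 => (δ, z)) ⁻¹' T₂ = ∅ := by
        ext δ
        simp only [hT₂, mem_preimage, mem_setOf_eq, mem_empty_iff_false, iff_false]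
        rintro ⟨-, hzF, -, -, -, hD⟩
        exact hz ⟨hzF, hD⟩
      rw [hslice, measure_empty, indicator_of_notMem hz]
  -- the `P`-slices at fixed `δ`: the two events of the hypothesis (with `S` cut down), or both empty
  have hslices : ∀ δ : V3,
      P (Prod.mk δ ⁻¹' T₁) ≤ P (Prod.mk δ ⁻¹' T₂) + B₃.indicator (fun _ => ENNReal.ofReal η) δ ∧
      P (Prod.mk δ ⁻¹' T₂) ≤ P (Prod.mk δ ⁻¹' T₁) + B₃.indicator (fun _ => ENNReal.ofReal η) δ := by
    intro δ
    by_cases hδ : δ ∈ B₃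
    · rw [indicator_of_mem hδ]
      have hS' : MeasurableSet (S ∩ {q : V3 × V3 | inner ℝ δ q.1 ∈ Set.Ioc (0 : ℝ) 1}) :=
        hS.inter ((measurable_const.inner measurable_fst) measurableSet_Ioc)
      have key := h δ _ hS'
      have e₁ : Prod.mk δ ⁻¹' T₁ = F ∩ {z | (g z, b z) ∈ S ∩ {q : V3 × V3 | inner ℝ δ q.1 ∈ Set.Ioc (0 : ℝ) 1} ∧
          (inner ℝ (b z) (g z) = 0 ∧ ‖b z‖ < 1) ∧
          (inner ℝ (b z - (δ - inner ℝ δ (g z) • g z)) (g z) = 0 ∧ ‖b z - (δ - inner ℝ δ (g z) • g z)‖ < 1)} := by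
        ext z
        simp only [hT₁, mem_preimage, mem_setOf_eq, mem_inter_iff]
        constructor
        · rintro ⟨-, hzF, hin, hzS, hD1, hD2⟩
          exact ⟨hzF, ⟨hzS, hin⟩, hD1, hD2⟩
        · rintro ⟨hzF, ⟨hzS, hin⟩, hD1, hD2⟩
          exact ⟨hδ, hzF, hin, hzS, hD1, hD2⟩
      have e₂ : Prod.mk δ ⁻¹' T₂ = F ∩ {z | (g z, b z + (δ - inner ℝ δ (g z) • g z)) ∈
          S ∩ {q : V3 × V3 | inner ℝ δ q.1 ∈ Set.Ioc (0 : ℝ) 1} ∧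
          (inner ℝ (b z + (δ - inner ℝ δ (g z) • g z)) (g z) = 0 ∧ ‖b z + (δ - inner ℝ δ (g z) • g z)‖ < 1) ∧
          (inner ℝ (b z) (g z) = 0 ∧ ‖b z‖ < 1)} := by
        ext z
        simp only [hT₂, mem_preimage, mem_setOf_eq, mem_inter_iff]
        constructor
        · rintro ⟨-, hzF, hin, hzS, hD1, hD2⟩
          exact ⟨hzF, ⟨hzS, hin⟩, hD1, hD2⟩
        · rintro ⟨hzF, ⟨hzS, hin⟩, hD1, hD2⟩
          exact ⟨hδ, hzF, hin, hzS, hD1, hD2⟩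
      rw [← e₁, ← e₂] at key
      have h1 : P.real (Prod.mk δ ⁻¹' T₁) ≤ P.real (Prod.mk δ ⁻¹' T₂) + η := by linarith [(abs_le.1 key).2]
      have h2 : P.real (Prod.mk δ ⁻¹' T₂) ≤ P.real (Prod.mk δ ⁻¹' T₁) + η := by linarith [(abs_le.1 key).1]
      constructor
      · have := ENNReal.ofReal_le_ofReal h1
        rwa [ENNReal.ofReal_add measureReal_nonneg hη, ofReal_measureReal, ofReal_measureReal] at this
      · have := ENNReal.ofReal_le_ofReal h2
        rwa [ENNReal.ofReal_add measureReal_nonneg hη, ofReal_measureReal, ofReal_measureReal] at this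
    · rw [indicator_of_notMem hδ, add_zero, add_zero]
      have e₁ : Prod.mk δ ⁻¹' T₁ = ∅ := by
        ext z
        simp only [hT₁, mem_preimage, mem_setOf_eq, mem_empty_iff_false, iff_false]
        exact fun hz => hδ hz.1
      have e₂ : Prod.mk δ ⁻¹' T₂ = ∅ := by
        ext z
        simp only [hT₂, mem_preimage, mem_setOf_eq, mem_empty_iff_false, iff_false]
        exact fun hz => hδ hz.1
      rw [e₁, e₂]
      exact ⟨le_rfl, le_rfl⟩
  -- integrate the slice inequalities over `δ`
  have hmeas₁ : Measurable fun δ : V3 => P (Prod.mk δ ⁻¹' T₁) := measurable_measure_prodMk_left hT₁m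
  have hmeas₂ : Measurable fun δ : V3 => P (Prod.mk δ ⁻¹' T₂) := measurable_measure_prodMk_left hT₂m
  have hJ₁ : V₀ * P A ≤ (volume.prod P) T₂ + ENNReal.ofReal η * volume B₃ := by
    calc V₀ * P A = ∫⁻ δ, P (Prod.mk δ ⁻¹' T₁) ∂volume := by rw [← hI₁, Measure.prod_apply hT₁m]
      _ ≤ ∫⁻ δ, (P (Prod.mk δ ⁻¹' T₂) + B₃.indicator (fun _ => ENNReal.ofReal η) δ) ∂volume :=
          lintegral_mono fun δ => (hslices δ).1
      _ = (volume.prod P) T₂ + ENNReal.ofReal η * volume B₃ := by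
          rw [lintegral_add_left hmeas₂, lintegral_indicator_const hB₃m, Measure.prod_apply hT₂m]
  have hJ₂ : (volume.prod P) T₂ ≤ V₀ * P A + ENNReal.ofReal η * volume B₃ := by
    calc (volume.prod P) T₂ = ∫⁻ δ, P (Prod.mk δ ⁻¹' T₂) ∂volume := by rw [Measure.prod_apply hT₂m]
      _ ≤ ∫⁻ δ, (P (Prod.mk δ ⁻¹' T₁) + B₃.indicator (fun _ => ENNReal.ofReal η) δ) ∂volume :=
          lintegral_mono fun δ => (hslices δ).2
      _ = V₀ * P A + ENNReal.ofReal η * volume B₃ := by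
          rw [lintegral_add_left hmeas₁, lintegral_indicator_const hB₃m, ← Measure.prod_apply hT₁m, hI₁]
  -- the compensator: `(vol ⊗ P) T₂ = ofReal (∫_{FD} discLaw) · V₀`
  set I : ℝ := ∫ z in FD, discLaw (g z) {u | (g z, u) ∈ S} ∂P with hI
  have hInn : 0 ≤ I := integral_nonneg fun z => discLaw_nonneg _ _
  have hfm : Measurable fun z => discLaw (g z) {u | (g z, u) ∈ S} := measurable_discLaw_comp hg hS
  have hInt : Integrable (fun z => discLaw (g z) {u | (g z, u) ∈ S}) (P.restrict FD) :=
    (integrable_const (1 : ℝ)).mono' hfm.aestronglyMeasurable (ae_of_all _ fun z => by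
      rw [Real.norm_eq_abs, abs_of_nonneg (discLaw_nonneg _ _)]
      exact discLaw_le_one _ _)
  have hI₂' : (volume.prod P) T₂ = ENNReal.ofReal I * V₀ := by
    rw [hI₂, hI, ofReal_integral_eq_lintegral_ofReal hInt (ae_of_all _ fun z => discLaw_nonneg _ _),
      ← lintegral_mul_const' _ _ hVt]
    refine setLIntegral_congr_fun hFDm fun z hz => ?_
    exact volume_discCylinder_inter_eq (g z) (hunit z hz.1) _
  rw [hI₂'] at hJ₁ hJ₂
  -- pass to real numbers
  have hB₃fin : volume B₃ ≠ ∞ := by rw [hB₃]; exact measure_closedBall_lt_top.ne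
  have hB₃r : (volume B₃).toReal = 36 * V₀.toReal := by rw [hB₃, hV₀]; exact volume_real_closedBall_three_eq
  have hVpos : 0 < V₀.toReal := ENNReal.toReal_pos hV0 hVt
  have hr₁ : V₀.toReal * P.real A ≤ I * V₀.toReal + η * (36 * V₀.toReal) := by
    have := ENNReal.toReal_mono (ENNReal.add_ne_top.2 ⟨ENNReal.mul_ne_top ENNReal.ofReal_ne_top hVt,
      ENNReal.mul_ne_top ENNReal.ofReal_ne_top hB₃fin⟩) hJ₁
    rw [ENNReal.toReal_add (ENNReal.mul_ne_top ENNReal.ofReal_ne_top hVt)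
        (ENNReal.mul_ne_top ENNReal.ofReal_ne_top hB₃fin),
      ENNReal.toReal_mul, ENNReal.toReal_mul, ENNReal.toReal_mul, ENNReal.toReal_ofReal hη,
      ENNReal.toReal_ofReal hInn, hB₃r] at this
    simpa [measureReal_def] using this
  have hr₂ : I * V₀.toReal ≤ V₀.toReal * P.real A + η * (36 * V₀.toReal) := by
    have := ENNReal.toReal_mono (ENNReal.add_ne_top.2 ⟨ENNReal.mul_ne_top hVt (measure_ne_top _ _),
      ENNReal.mul_ne_top ENNReal.ofReal_ne_top hB₃fin⟩) hJ₂
    rw [ENNReal.toReal_add (ENNReal.mul_ne_top hVt (measure_ne_top _ _))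
        (ENNReal.mul_ne_top ENNReal.ofReal_ne_top hB₃fin),
      ENNReal.toReal_mul, ENNReal.toReal_mul, ENNReal.toReal_mul, ENNReal.toReal_ofReal hη,
      ENNReal.toReal_ofReal hInn, hB₃r] at this
    simpa [measureReal_def] using this
  -- divide by `V₀ > 0`
  have h1 : P.real A ≤ I + 36 * η := by
    have : V₀.toReal * P.real A ≤ V₀.toReal * (I + 36 * η) := by nlinarith
    exact le_of_mul_le_mul_left this hVpos
  have h2 : I ≤ P.real A + 36 * η := by
    have : V₀.toReal * I ≤ V₀.toReal * (P.real A + 36 * η) := by nlinarith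
    exact le_of_mul_le_mul_left this hVpos
  rw [abs_le]
  constructor <;> linarith

end

end Summit.AtomisticToContinuum.HydrodynamicLimit.Theorems.OLC
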